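import Summits.QuantumFields.BalabanUV.Gaps.EndUpperPerLevel
import Summits.QuantumFields.BalabanUV.Gaps.EndContAlongFoliation

/-!
# Gaps / EndSurvivorExtension — the letters are read ON THE SURVIVOR SETS ONLY: for the in-interval runs of (0.20) nothing off the closed sets
# `S_k = {x ∈ ]0,γ₀] : Y_j(x) ≥ 1∕γ₀², j ≤ k}` (the initial couplings of the runs of length `k`) is ever read — the BARE-COUPLING EXTENSION FAMILY
# `extH`, run equivalence for tables agreeing with β's traces on the survivor sets, closedness of the survivor sets, TIETZE EXTENSION of the
# survivor traces, and the W-β road from run-wise (PS) with per-level bounds — a PORT into the tree, with attribution, of g1-plan-2 GEN 19's lens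
# kernel `HOME/g1/skeletons/XreadHordFadingMemory_plan2.lean` (v1.9, sha16 b3bd94734a28a3a0, §14 `section SurvivorCensus`, first half; lens item S-46 ∕ R-38)
# (cell pub-balaban-gaps, seat g1-p3 gen 7, row CAP+tail ∕ β-currency «split ∕ weakening»; file 7 of «the binder census of the END roads»)

HONEST FRAMING (cell rule, page 1 of everything): [folklore] real analysis (Tietze–Urysohn on a closed subset of the normal space `]0,γ₀]`) over
the tree's typed carriers (`FlowStep.HBeta` ∕ `Y` ∕ `gClamp` ∕ `clampPrefix` ∕ `RGEqH`, `FlowStepRuns`, `DagBinding.ForwardGenerated` ∕ `EndpointExistence`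
∕ `modelOf`, `EndRunwiseShooting.survives_of_run` ∕ `Y_eq_of_run` ∕ `endpointExistence_of_runwisePS`).  AUTHORSHIP: the mathematics and the Lean
text of every declaration below are g1-plan-2 GEN 19's (planner seat; planners file nothing on the ledger by mandate — «provers may port», offered in
[G1-PLAN2-G19-XREAD-PA-PD] ∕ [G1-PLAN2-G19-XREAD-A1-SIX]); this seat's contribution is the port (namespace, imports, this header, one added docstring,
two references re-pointed to the tree's leaves) and the kernel re-check against the tree.  Every β-side hypothesis (survivor continuity, survivor
bounds, run-wise (PS), non-crossing) is a BINDER (a hypothesis SHAPE); for Bałaban's β continuity in the coupling is ASSERTED in print ([I] §1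
pp. 263–264; no located proof — GAPS G-adv2-3 ∕ G-adv2-6), so NO word of record moves.  `EndpointExistence` appears only as a conclusion of ∕ inside
an equivalence with hypotheses named in the signature.  NOTHING of Bałaban's is asserted; 0∕6 binders; 0 coefficients certified; one finite T⁴;
NOT B12 Thm 2, NOT `BetaPertH`, NOT the continuum limit, NOT Clay.

THE POINT (g1-plan-2 S-46 ∕ R-38, verbatim in substance; the residual of `Gaps/EndContAlongFoliation`'s NOT-CLAIMED clause).  The γ₀-clamped forward
foliation has two kinds of leaves: from `x ∈ S_k` the clamped prefix of length `k` is UNCLAMPED — it IS the prefix `(g_0,…,g_k)` of the in-interval run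
of (0.20) from `g_0 = x` (`survivor_iff_run` in the companion leaf) — while from `x ∉ S_k` it is a fictitious history sitting at `γ₀` after the exit
step.  This leaf supplies the tools showing that the fictitious leaves carry NO information any END socket reads: the extension family
**`extH F k v := F_k(v 0)`** (`betaContH_extH`, `betaUpperH_extH`, `perLevelUpper_extH`); RUN EQUIVALENCE for any table `F` agreeing with β's traces
on the survivor sets (`rgEqH_extH_of_rgEqH`, `rgEqH_of_rgEqH_extH`; hence `hord_extH`, `runwisePS_extH`); the survivor sets are CLOSED in `]0,γ₀]`
(`continuousOn_Y_succ_survivors`, **`isClosed_survivors`**); TIETZE IN THE BARE COUPLING (**`exists_extension_of_survivorLetters`**: survivor-continuous,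
survivor-bounded traces extend to a table continuous and bounded on all of `]0,γ₀]`, `ContinuousMap.exists_restrict_eq_forall_mem_of_closed`);
**`survivor_iff_run`** (`S_k` = the set of initial couplings of the in-interval runs of length `k`); and
the W-β road from RUN-WISE (PS) with PER-LEVEL bounds (`runwisePS_truncH`, **`endpointExistence_of_runwisePS_locUpper`** =
`EndRunwiseShooting.endpointExistence_of_runwisePS` with `hβ′` gone and (U) per level, by truncation).  The END criteria on the survivor sets and the
census R-38 are the companion leaf `Gaps/EndSurvivorCensus`.
0 sorry; ONE auxiliary function `extH : (ℕ → ℝ → ℝ) → HBeta` (no `def … : Prop`, no toy family); imports `Gaps/EndUpperPerLevel` +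
`Gaps/EndContAlongFoliation` (which re-export (D), (A), `FlowStepRuns`); restates nothing of the tree.

CITATION HEADER (tags CONTEXT ONLY).  [I] = T. Bałaban, Commun. Math. Phys. **109** (1987) [Balaban1987RG1]: Thm 2 p. 259, (0.20) p. 256,
§1 pp. 263–264.
-/

namespace Summit.QuantumFields.BalabanUV.Gaps.EndSurvivorExtension

open Literature.MathematicalPhysics.QuantumFieldTheory.Balaban1983to89
open Literature.MathematicalPhysics.QuantumFieldTheory.Balaban1983to89.FlowStep
open Literature.MathematicalPhysics.QuantumFieldTheory.Balaban1983to89.FlowStepRuns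
open Literature.MathematicalPhysics.QuantumFieldTheory.Balaban1983to89.DagBinding
open Summit.QuantumFields.BalabanUV.Gaps.EndRunwiseShooting
open Summit.QuantumFields.BalabanUV.Gaps.EndTopRunCriterion
open Summit.QuantumFields.BalabanUV.Gaps.EndUpperPerLevel
open Summit.QuantumFields.BalabanUV.Gaps.EndContAlongFoliation
open Topology Finset

noncomputable section

/-! ## §1 The extension family `extH`; run equivalence on the survivor sets; closedness; Tietze; run-wise (PS) with per-level bounds
(g1-plan-2 kernel §14, first half, ported) -/

/-- THE BARE-COUPLING EXTENSION FAMILY of a one-variable table `F : ℕ → ℝ → ℝ`: `(extH F)_k (g_0,…,g_k) := F_k(g_0)` — a history-dependent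
family that reads only the INITIAL coupling (an auxiliary FUNCTION on the tree's carrier `HBeta`, not a `Prop`; nothing of Bałaban's). [folklore] -/
def extH (F : ℕ → ℝ → ℝ) : HBeta := fun k v => F k (v 0)

/-- Unfolding. [folklore] -/
theorem extH_apply (F : ℕ → ℝ → ℝ) (k : ℕ) (v : Fin (k + 1) → ℝ) : extH F k v = F k (v 0) := rfl

/-- The γ₀-clamped forward prefix from `x ∈ ]0,γ₀]` STARTS AT `x` (any family). [folklore] -/
theorem clampPrefix_zero {β : HBeta} {γ₀ : ℝ} (k : ℕ) {x : ℝ} (hx : 0 < x) (hxγ : x ≤ γ₀) :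
    clampPrefix β γ₀ k x 0 = x := by
  show gClamp γ₀ (Y β γ₀ ((0 : Fin (k + 1)) : ℕ) x) = x
  rw [Fin.val_zero, Y_zero, gClamp_inv_sq hx hxγ]

/-- … so the trace of `extH F` along its own clamped foliation is the table `F` itself. [folklore] -/
theorem extH_trace {F : ℕ → ℝ → ℝ} {γ₀ : ℝ} (k : ℕ) {x : ℝ} (hx : 0 < x) (hxγ : x ≤ γ₀) :
    extH F k (clampPrefix (extH F) γ₀ k x) = F k x := by
  rw [extH_apply, clampPrefix_zero k hx hxγ]

/-- (C) for the extension family from continuity of each `F_k` on `]0,γ₀]`. [folklore] -/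
theorem betaContH_extH {F : ℕ → ℝ → ℝ} {γ₀ : ℝ} (hF : ∀ k : ℕ, ContinuousOn (F k) (Set.Ioc 0 γ₀)) :
    BetaContH γ₀ (extH F) := by
  intro k
  have h0 : Continuous fun v : Fin (k + 1) → ℝ => v 0 := continuous_apply 0
  exact (hF k).comp h0.continuousOn fun v hv => (mem_box.mp hv) 0

/-- (U) (uniform) for the extension family. [folklore] -/
theorem betaUpperH_extH {F : ℕ → ℝ → ℝ} {γ₀ β' : ℝ} (hF : ∀ (k : ℕ) (x : ℝ), 0 < x → x ≤ γ₀ → F k x ≤ β') :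
    BetaUpperH β' γ₀ (extH F) :=
  fun k v hv => hF k (v 0) ((mem_box.mp hv) 0).1 ((mem_box.mp hv) 0).2

/-- (U) per level for the extension family. [folklore] -/
theorem perLevelUpper_extH {F : ℕ → ℝ → ℝ} {γ₀ : ℝ} (hF : ∀ k : ℕ, ∃ B : ℝ, ∀ x : ℝ, 0 < x → x ≤ γ₀ → F k x ≤ B) :
    ∀ k : ℕ, ∃ B : ℝ, ∀ v : Fin (k + 1) → ℝ, v ∈ Box γ₀ k → extH F k v ≤ B := by
  intro k
  obtain ⟨B, hB⟩ := hF k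
  exact ⟨B, fun v hv => hB (v 0) ((mem_box.mp hv) 0).1 ((mem_box.mp hv) 0).2⟩

/-! ### Run equivalence: a table that AGREES WITH β'S TRACES ON THE SURVIVOR SETS generates the same in-interval runs at every level `≤ γ₀` -/

/-- Every in-interval `β`-run (level `γ ≤ γ₀`) is an `extH F`-run, provided `F_k` agrees with the `k`-th trace of `β` on the survivor set
`S_k = {x ∈ ]0,γ₀] : Y_j(x) ≥ 1∕γ₀², j ≤ k}` (the run's initial coupling lies in `S_n ⊆ S_k`, `EndRunwiseShooting.survives_of_run`, and its
prefix IS the clamped prefix, `EndRunwiseShooting.Y_eq_of_run`). [folklore] -/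
theorem rgEqH_extH_of_rgEqH {β : HBeta} {F : ℕ → ℝ → ℝ} {γ₀ γ : ℝ} (hγle : γ ≤ γ₀)
    (hagree : ∀ (k : ℕ) (x : ℝ), 0 < x → x ≤ γ₀ → (∀ j, j ≤ k → 1 / γ₀ ^ 2 ≤ Y β γ₀ j x) →
      F k x = β k (clampPrefix β γ₀ k x))
    {n : ℕ} {gs : ℕ → ℝ} (hrg : RGEqH n β gs) (hI : Step.InInterval γ n gs) : RGEqH n (extH F) gs := by
  have hI₀ : Step.InInterval γ₀ n gs := fun j hj => ⟨(hI j hj).1, (hI j hj).2.trans hγle⟩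
  have hx : 0 < gs 0 := (hI₀ 0 (Nat.zero_le _)).1
  have hxγ : gs 0 ≤ γ₀ := (hI₀ 0 (Nat.zero_le _)).2
  intro k hk
  have e : extH F k (prefixOf gs k) = β k (prefixOf gs k) := by
    rw [extH_apply, prefixOf_apply, Fin.val_zero,
      hagree k (gs 0) hx hxγ (fun j hj => survives_of_run hrg hI₀ j (hj.trans hk.le)), (Y_eq_of_run hrg hI₀ k hk.le).2]
  rw [e]
  exact hrg k hk

/-- … and conversely every in-interval `extH F`-run is a `β`-run (induction on the length: the `β`-prefix already established is a survivor
from `gs 0`, so the next equation reads `F_k(gs 0) = β_k(prefix)`).  SAME IN-INTERVAL RUNS AT EVERY LEVEL `γ ≤ γ₀`. [folklore] -/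
theorem rgEqH_of_rgEqH_extH {β : HBeta} {F : ℕ → ℝ → ℝ} {γ₀ γ : ℝ} (hγle : γ ≤ γ₀)
    (hagree : ∀ (k : ℕ) (x : ℝ), 0 < x → x ≤ γ₀ → (∀ j, j ≤ k → 1 / γ₀ ^ 2 ≤ Y β γ₀ j x) →
      F k x = β k (clampPrefix β γ₀ k x))
    {n : ℕ} {gs : ℕ → ℝ} (hrg : RGEqH n (extH F) gs) (hI : Step.InInterval γ n gs) : RGEqH n β gs := by
  have hI₀ : Step.InInterval γ₀ n gs := fun j hj => ⟨(hI j hj).1, (hI j hj).2.trans hγle⟩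
  have hx : 0 < gs 0 := (hI₀ 0 (Nat.zero_le _)).1
  have hxγ : gs 0 ≤ γ₀ := (hI₀ 0 (Nat.zero_le _)).2
  have main : ∀ k : ℕ, k ≤ n → RGEqH k β gs := by
    intro k
    induction k with
    | zero => intro _ j hj; exact absurd hj (Nat.not_lt_zero _)
    | succ k ih =>
      intro hk j hj
      have hk' : k < n := Nat.lt_of_succ_le hk
      have hrgk : RGEqH k β gs := ih hk'.le
      rcases Nat.lt_succ_iff_lt_or_eq.mp hj with hjk | rfl
      · exact hrgk j hjk
      · have hIk : Step.InInterval γ₀ j gs := fun i hi => hI₀ i (hi.trans hk'.le)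
        have e : extH F j (prefixOf gs j) = β j (prefixOf gs j) := by
          rw [extH_apply, prefixOf_apply, Fin.val_zero,
            hagree j (gs 0) hx hxγ (survives_of_run hrgk hIk), (Y_eq_of_run hrgk hIk j le_rfl).2]
        rw [← e]
        exact hrg j hk'
  exact main n le_rfl

/-- Non-crossing transfers to the extension family (same runs). [folklore] -/
theorem hord_extH {β : HBeta} {F : ℕ → ℝ → ℝ} {γ₀ : ℝ}
    (hagree : ∀ (k : ℕ) (x : ℝ), 0 < x → x ≤ γ₀ → (∀ j, j ≤ k → 1 / γ₀ ^ 2 ≤ Y β γ₀ j x) →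
      F k x = β k (clampPrefix β γ₀ k x))
    (hord : ∀ γ : ℝ, 0 < γ → γ ≤ γ₀ → ∀ (n : ℕ) (gs gs' : ℕ → ℝ), RGEqH n β gs → RGEqH n β gs' →
      Step.InInterval γ n gs → Step.InInterval γ n gs' → gs 0 < gs' 0 → ∀ k, k ≤ n → gs k < gs' k) :
    ∀ γ : ℝ, 0 < γ → γ ≤ γ₀ → ∀ (n : ℕ) (gs gs' : ℕ → ℝ), RGEqH n (extH F) gs → RGEqH n (extH F) gs' →
      Step.InInterval γ n gs → Step.InInterval γ n gs' → gs 0 < gs' 0 → ∀ k, k ≤ n → gs k < gs' k :=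
  fun γ hγ hγle n gs gs' hrg hrg' hI hI' h0 =>
    hord γ hγ hγle n gs gs' (rgEqH_of_rgEqH_extH hγle hagree hrg hI) (rgEqH_of_rgEqH_extH hγle hagree hrg' hI') hI hI' h0

/-- Run-wise (PS) at level γ₀ transfers to the extension family (same runs, and along a run the family IS β). [folklore] -/
theorem runwisePS_extH {β : HBeta} {F : ℕ → ℝ → ℝ} {γ₀ M : ℝ}
    (hagree : ∀ (k : ℕ) (x : ℝ), 0 < x → x ≤ γ₀ → (∀ j, j ≤ k → 1 / γ₀ ^ 2 ≤ Y β γ₀ j x) →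
      F k x = β k (clampPrefix β γ₀ k x))
    (hrun : ∀ (n : ℕ) (gs : ℕ → ℝ), RGEqH n β gs → Step.InInterval γ₀ n gs →
      ∀ k, k ≤ n → -M ≤ ∑ j ∈ Finset.Ico k n, β j (prefixOf gs j)) :
    ∀ (n : ℕ) (gs : ℕ → ℝ), RGEqH n (extH F) gs → Step.InInterval γ₀ n gs →
      ∀ k, k ≤ n → -M ≤ ∑ j ∈ Finset.Ico k n, extH F j (prefixOf gs j) := by
  intro n gs hrg hI k hk
  have hrgβ : RGEqH n β gs := rgEqH_of_rgEqH_extH le_rfl hagree hrg hI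
  have hx : 0 < gs 0 := (hI 0 (Nat.zero_le _)).1
  have hxγ : gs 0 ≤ γ₀ := (hI 0 (Nat.zero_le _)).2
  have e : ∀ j ∈ Finset.Ico k n, extH F j (prefixOf gs j) = β j (prefixOf gs j) := by
    intro j hj
    have hjn : j < n := (Finset.mem_Ico.mp hj).2
    rw [extH_apply, prefixOf_apply, Fin.val_zero,
      hagree j (gs 0) hx hxγ (fun i hi => survives_of_run hrgβ hI i (hi.trans hjn.le)), (Y_eq_of_run hrgβ hI j hjn.le).2]
  rw [Finset.sum_congr rfl e]
  exact hrun n gs hrgβ hI k hk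

/-! ### The survivor sets are relatively closed; Tietze extension of the survivor traces -/

/-- If the `k`-th trace is continuous on the survivor set `S_k` for every `k`, then the clamped table `Y_{k+1}` is continuous on `S_k`
(`Y_{k+1} = Y_k − trace_k`, induction). [folklore] -/
theorem continuousOn_Y_succ_survivors {β : HBeta} {γ₀ : ℝ}
    (hsc : ∀ k : ℕ, ContinuousOn (fun x : ℝ => β k (clampPrefix β γ₀ k x))
      {x : ℝ | 0 < x ∧ x ≤ γ₀ ∧ ∀ j, j ≤ k → 1 / γ₀ ^ 2 ≤ Y β γ₀ j x}) :
    ∀ k : ℕ, ContinuousOn (Y β γ₀ (k + 1)) {x : ℝ | 0 < x ∧ x ≤ γ₀ ∧ ∀ j, j ≤ k → 1 / γ₀ ^ 2 ≤ Y β γ₀ j x} := by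
  intro k
  induction k with
  | zero =>
    have e : Y β γ₀ (0 + 1) = fun x => 1 / x ^ 2 - β 0 (clampPrefix β γ₀ 0 x) :=
      funext fun x => by rw [Y_succ' (β := β) (γ := γ₀) 0 x, Y_zero]
    rw [e]
    refine ContinuousOn.sub ?_ (hsc 0)
    exact continuousOn_const.div (continuous_pow 2).continuousOn fun x hx => pow_ne_zero 2 (ne_of_gt hx.1)
  | succ k ih =>
    have e : Y β γ₀ (k + 1 + 1) = fun x => Y β γ₀ (k + 1) x - β (k + 1) (clampPrefix β γ₀ (k + 1) x) :=
      funext fun x => Y_succ' (β := β) (γ := γ₀) (k + 1) x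
    rw [e]
    refine ContinuousOn.sub (ih.mono ?_) (hsc (k + 1))
    intro x hx
    exact ⟨hx.1, hx.2.1, fun j hj => hx.2.2 j (hj.trans (Nat.le_succ k))⟩

/-- THE SURVIVOR SETS ARE CLOSED in the subspace `]0,γ₀]` (`S_0 = ]0,γ₀]`; `S_{k+1} = S_k ∩ {Y_{k+1} ≥ 1∕γ₀²}` with `Y_{k+1}` continuous on
`S_k`). [folklore] -/
theorem isClosed_survivors {β : HBeta} {γ₀ : ℝ}
    (hsc : ∀ k : ℕ, ContinuousOn (fun x : ℝ => β k (clampPrefix β γ₀ k x))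
      {x : ℝ | 0 < x ∧ x ≤ γ₀ ∧ ∀ j, j ≤ k → 1 / γ₀ ^ 2 ≤ Y β γ₀ j x}) :
    ∀ k : ℕ, IsClosed {p : Set.Ioc (0 : ℝ) γ₀ | ∀ j, j ≤ k → 1 / γ₀ ^ 2 ≤ Y β γ₀ j p.1} := by
  intro k
  induction k with
  | zero =>
    have e : {p : Set.Ioc (0 : ℝ) γ₀ | ∀ j, j ≤ 0 → 1 / γ₀ ^ 2 ≤ Y β γ₀ j p.1} = Set.univ := by
      ext p
      simp only [Set.mem_setOf_eq, Set.mem_univ, iff_true]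
      intro j hj
      obtain rfl := Nat.le_zero.mp hj
      rw [Y_zero]
      exact one_div_le_one_div_of_le (pow_pos p.2.1 2) (pow_le_pow_left₀ p.2.1.le p.2.2 2)
    rw [e]
    exact isClosed_univ
  | succ k ih =>
    have hcont : ContinuousOn (fun p : Set.Ioc (0 : ℝ) γ₀ => Y β γ₀ (k + 1) p.1)
        {p : Set.Ioc (0 : ℝ) γ₀ | ∀ j, j ≤ k → 1 / γ₀ ^ 2 ≤ Y β γ₀ j p.1} :=
      (continuousOn_Y_succ_survivors hsc k).comp continuous_subtype_val.continuousOn fun p hp => ⟨p.2.1, p.2.2, hp⟩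
    have e : {p : Set.Ioc (0 : ℝ) γ₀ | ∀ j, j ≤ k + 1 → 1 / γ₀ ^ 2 ≤ Y β γ₀ j p.1} =
        {p : Set.Ioc (0 : ℝ) γ₀ | ∀ j, j ≤ k → 1 / γ₀ ^ 2 ≤ Y β γ₀ j p.1} ∩
          (fun p : Set.Ioc (0 : ℝ) γ₀ => Y β γ₀ (k + 1) p.1) ⁻¹' Set.Ici (1 / γ₀ ^ 2) := by
      ext p
      simp only [Set.mem_setOf_eq, Set.mem_inter_iff, Set.mem_preimage, Set.mem_Ici]
      constructor
      · intro h
        exact ⟨fun j hj => h j (hj.trans (Nat.le_succ k)), h (k + 1) le_rfl⟩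
      · rintro ⟨h, hk⟩ j hj
        rcases Nat.le_succ_iff.mp hj with hjk | rfl
        · exact h j hjk
        · exact hk
    rw [e]
    exact hcont.preimage_isClosed_of_isClosed ih isClosed_Ici

/-- **TIETZE IN THE BARE COUPLING.**  If every trace `x ↦ β_k(clampPrefix β γ₀ k x)` is continuous on its survivor set `S_k` and bounded above
there by `B_k`, there is a table `F` of functions CONTINUOUS ON ALL OF `]0,γ₀]`, with the same bounds, agreeing with the traces on the survivor
sets (Tietze–Urysohn on the closed subset `S_k` of the normal space `]0,γ₀]`, target interval `]-∞,B_k]`). [folklore] -/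
theorem exists_extension_of_survivorLetters {β : HBeta} {γ₀ : ℝ} {B : ℕ → ℝ}
    (hsc : ∀ k : ℕ, ContinuousOn (fun x : ℝ => β k (clampPrefix β γ₀ k x))
      {x : ℝ | 0 < x ∧ x ≤ γ₀ ∧ ∀ j, j ≤ k → 1 / γ₀ ^ 2 ≤ Y β γ₀ j x})
    (hsu : ∀ (k : ℕ) (x : ℝ), 0 < x → x ≤ γ₀ → (∀ j, j ≤ k → 1 / γ₀ ^ 2 ≤ Y β γ₀ j x) →
      β k (clampPrefix β γ₀ k x) ≤ B k) :
    ∃ F : ℕ → ℝ → ℝ, (∀ k : ℕ, ContinuousOn (F k) (Set.Ioc 0 γ₀)) ∧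
      (∀ (k : ℕ) (x : ℝ), 0 < x → x ≤ γ₀ → F k x ≤ B k) ∧
      ∀ (k : ℕ) (x : ℝ), 0 < x → x ≤ γ₀ → (∀ j, j ≤ k → 1 / γ₀ ^ 2 ≤ Y β γ₀ j x) →
        F k x = β k (clampPrefix β γ₀ k x) := by
  have key : ∀ k : ℕ, ∃ Fk : ℝ → ℝ, ContinuousOn Fk (Set.Ioc 0 γ₀) ∧ (∀ x : ℝ, 0 < x → x ≤ γ₀ → Fk x ≤ B k) ∧
      ∀ x : ℝ, 0 < x → x ≤ γ₀ → (∀ j, j ≤ k → 1 / γ₀ ^ 2 ≤ Y β γ₀ j x) → Fk x = β k (clampPrefix β γ₀ k x) := by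
    intro k
    -- the survivor set as a closed subset of the normal space `]0,γ₀]`, and the trace as a continuous map on it
    let s : Set (Set.Ioc (0 : ℝ) γ₀) := {p | ∀ j, j ≤ k → 1 / γ₀ ^ 2 ≤ Y β γ₀ j p.1}
    have hs : IsClosed s := isClosed_survivors hsc k
    have hf : Continuous fun q : s => β k (clampPrefix β γ₀ k q.1.1) :=
      (hsc k).comp_continuous (continuous_subtype_val.comp continuous_subtype_val) fun q => ⟨q.1.2.1, q.1.2.2, q.2⟩
    let f : C(s, ℝ) := ⟨fun q => β k (clampPrefix β γ₀ k q.1.1), hf⟩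
    have hfq : ∀ q : s, f q = β k (clampPrefix β γ₀ k q.1.1) := fun q => rfl
    have hft : ∀ q, f q ∈ Set.Iic (B k) := fun q => Set.mem_Iic.mpr (hsu k q.1.1 q.1.2.1 q.1.2.2 q.2)
    obtain ⟨g, hgt, hgf⟩ := f.exists_restrict_eq_forall_mem_of_closed hft ⟨B k, Set.mem_Iic.mpr le_rfl⟩ hs
    refine ⟨fun x => if h : 0 < x ∧ x ≤ γ₀ then g ⟨x, h⟩ else B k, ?_, ?_, ?_⟩
    · rw [continuousOn_iff_continuous_restrict]
      have e : (Set.Ioc (0 : ℝ) γ₀).restrict (fun x => if h : 0 < x ∧ x ≤ γ₀ then g ⟨x, h⟩ else B k) = g := by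
        funext p
        have hp : 0 < (p : ℝ) ∧ (p : ℝ) ≤ γ₀ := p.2
        simp only [Set.restrict_apply, dif_pos hp, Subtype.coe_eta]
      rw [e]
      exact g.continuous
    · intro x hx hxγ
      have h : 0 < x ∧ x ≤ γ₀ := ⟨hx, hxγ⟩
      simp only [dif_pos h]
      exact Set.mem_Iic.mp (hgt _)
    · intro x hx hxγ hsurv
      have h : 0 < x ∧ x ≤ γ₀ := ⟨hx, hxγ⟩
      simp only [dif_pos h]
      have := congrArg (fun φ : C(s, ℝ) => φ ⟨⟨x, h⟩, hsurv⟩) hgf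
      simpa [hfq] using this
  choose F hF using key
  exact ⟨F, fun k => (hF k).1, fun k => (hF k).2.1, fun k => (hF k).2.2⟩


/-- THE SURVIVOR SET `S_k` IS THE SET OF INITIAL COUPLINGS OF THE IN-INTERVAL RUNS OF LENGTH `k` (level γ₀): survivors are runs
(`EndRunwiseShooting.rgEqH_shoot_of_survives`) and runs are survivors (`EndRunwiseShooting.survives_of_run`). [folklore] -/
theorem survivor_iff_run {β : HBeta} {γ₀ : ℝ} (hγ₀ : 0 < γ₀) (k : ℕ) (x : ℝ) :
    (0 < x ∧ x ≤ γ₀ ∧ ∀ j, j ≤ k → 1 / γ₀ ^ 2 ≤ Y β γ₀ j x) ↔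
      ∃ gs : ℕ → ℝ, gs 0 = x ∧ RGEqH k β gs ∧ Step.InInterval γ₀ k gs := by
  constructor
  · rintro ⟨hx, hxγ, hsurv⟩
    exact ⟨fun i => gClamp γ₀ (Y β γ₀ i x), shoot_zero hx hxγ, rgEqH_shoot_of_survives hγ₀ hsurv, inInterval_shoot hγ₀ k x⟩
  · rintro ⟨gs, rfl, hrg, hI⟩
    exact ⟨(hI 0 (Nat.zero_le _)).1, (hI 0 (Nat.zero_le _)).2, survives_of_run hrg hI⟩

/-- Run-wise (PS) (level `γ`, `0 ≤ M`) transfers to every truncation: a `truncH β K`-run is a `β`-run up to `min n K`, zeros after. [folklore] -/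
theorem runwisePS_truncH {β : HBeta} {γ M : ℝ} (hM : 0 ≤ M)
    (hrun : ∀ (n : ℕ) (gs : ℕ → ℝ), RGEqH n β gs → Step.InInterval γ n gs →
      ∀ k, k ≤ n → -M ≤ ∑ j ∈ Finset.Ico k n, β j (prefixOf gs j)) (K : ℕ) :
    ∀ (n : ℕ) (gs : ℕ → ℝ), RGEqH n (truncH β K) gs → Step.InInterval γ n gs →
      ∀ k, k ≤ n → -M ≤ ∑ j ∈ Finset.Ico k n, truncH β K j (prefixOf gs j) := by
  intro n gs hrg hI k hkn
  have hrgβ : RGEqH (min n K) β gs := rgEqH_of_truncH hrg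
  have hIβ : Step.InInterval γ (min n K) gs := fun i hi => hI i (hi.trans (min_le_left _ _))
  by_cases hnK : n ≤ K
  · have h1 : ∑ j ∈ Finset.Ico k n, truncH β K j (prefixOf gs j) = ∑ j ∈ Finset.Ico k n, β j (prefixOf gs j) :=
      Finset.sum_congr rfl fun j hj => by rw [truncH_of_lt (lt_of_lt_of_le (Finset.mem_Ico.mp hj).2 hnK)]
    rw [h1]
    have h := hrun (min n K) gs hrgβ hIβ k (by rw [min_eq_left hnK]; exact hkn)
    rwa [min_eq_left hnK] at h
  · have hKn : K ≤ n := (not_le.mp hnK).le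
    by_cases hkK : k ≤ K
    · rw [← Finset.sum_Ico_consecutive _ hkK hKn]
      have h1 : ∑ j ∈ Finset.Ico k K, truncH β K j (prefixOf gs j) = ∑ j ∈ Finset.Ico k K, β j (prefixOf gs j) :=
        Finset.sum_congr rfl fun j hj => by rw [truncH_of_lt (Finset.mem_Ico.mp hj).2]
      have h2 : ∑ j ∈ Finset.Ico K n, truncH β K j (prefixOf gs j) = 0 :=
        Finset.sum_eq_zero fun j hj => by rw [truncH_of_le (Finset.mem_Ico.mp hj).1, Pi.zero_apply]
      rw [h1, h2, add_zero]
      have h := hrun (min n K) gs hrgβ hIβ k (by rw [min_eq_right hKn]; exact hkK)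
      rwa [min_eq_right hKn] at h
    · have h2 : ∑ j ∈ Finset.Ico k n, truncH β K j (prefixOf gs j) = 0 :=
        Finset.sum_eq_zero fun j hj => by
          rw [truncH_of_le ((not_le.mp hkK).le.trans (Finset.mem_Ico.mp hj).1), Pi.zero_apply]
      rw [h2]
      linarith

/-- **The W-β road from RUN-WISE (PS) with PER-LEVEL upper bounds** (construction level; `ForwardGenerated` only):
`EndRunwiseShooting.endpointExistence_of_runwisePS` with `hβ'` GONE and (U) replaced by «`∀ k, ∃ B_k, β_k ≤ B_k` on `Box γ₀ k`»; same
`g⋆ = (1∕γ² + M)^{−1∕2}`.  Proof: the tree's `couplingTrajectory_exists_of_runwisePS` for the truncation `EndUpperPerLevel.truncH β K` at each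
horizon (`Gaps/EndUpperPerLevel`'s pattern). [cite: Balaban1987RG1, Thm 2 p.259 and (0.20) p.256] -/
theorem endpointExistence_of_runwisePS_locUpper {C : B12.Construction} {β : HBeta} (hgen : ForwardGenerated C β)
    {γ₀ M : ℝ} (hγ₀ : 0 < γ₀) (hM : 0 ≤ M) (hcont : BetaContH γ₀ β)
    (hloc : ∀ k : ℕ, ∃ B : ℝ, ∀ v : Fin (k + 1) → ℝ, v ∈ Box γ₀ k → β k v ≤ B)
    (hrun : ∀ (n : ℕ) (gs : ℕ → ℝ), RGEqH n β gs → Step.InInterval γ₀ n gs →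
      ∀ k, k ≤ n → -M ≤ ∑ j ∈ Finset.Ico k n, β j (prefixOf gs j)) :
    EndpointExistence C := by
  intro m
  refine ⟨γ₀, hγ₀, fun γ hγ hγle => ?_⟩
  set gstar : ℝ := 1 / Real.sqrt (1 / γ ^ 2 + M) with hgstar
  have hgstar_pos : 0 < gstar := by positivity
  refine ⟨gstar, hgstar_pos, fun g hg hgle K => ?_⟩
  have hgs : 1 / gstar ^ 2 = 1 / γ ^ 2 + M := by
    rw [hgstar, div_pow, one_pow, Real.sq_sqrt (by positivity), one_div_one_div]
  have hgM : 1 / γ ^ 2 + M ≤ 1 / g ^ 2 := by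
    rw [← hgs]
    exact one_div_le_one_div_of_le (by positivity) (pow_le_pow_left₀ hg.le hgle 2)
  have hcont' : BetaContH γ (truncH β K) := fun k => (betaContH_truncH hcont K k).mono (box_mono hγle k)
  obtain ⟨β', hβ', hhi⟩ := betaUpperH_truncH (perLevelUpper_mono hγle hloc) K
  have hrunγ : ∀ (n : ℕ) (gs : ℕ → ℝ), RGEqH n β gs → Step.InInterval γ n gs →
      ∀ k, k ≤ n → -M ≤ ∑ j ∈ Finset.Ico k n, β j (prefixOf gs j) :=
    fun n gs hrg hI => hrun n gs hrg fun i hi => ⟨(hI i hi).1, (hI i hi).2.trans hγle⟩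
  obtain ⟨gs, hgsK, hrg, hI, -⟩ := couplingTrajectory_exists_of_runwisePS (truncH β K) hγ hM hβ' hcont' hhi
    (runwisePS_truncH hM hrunγ K) K g hg hgM
  have hrgβ : RGEqH K β gs := by
    have h := rgEqH_of_truncH hrg
    rwa [min_self] at h
  have heq : ∀ k, k ≤ K → (C ⟨K, m, gs 0⟩).flow.g k = gs k :=
    flow_eq_of_rgEqH (C ⟨K, m, gs 0⟩).flow β K (fun k hk => hgen.2 ⟨K, m, gs 0⟩ k hk)
      (hgen.1 ⟨K, m, gs 0⟩) hrgβ (fun k hk => (hI k hk).1)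
  refine ⟨gs 0, fun k hk => ?_, ?_⟩
  · rw [heq k hk]; exact hI k hk
  · rw [heq K le_rfl]; exact hgsK

end

end Summit.QuantumFields.BalabanUV.Gaps.EndSurvivorExtension
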